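import Summits.HodgeConjecture.HodgeConjecture.Theorems.MarkmanPartnerTransportPartnerTransportIncidence
import Summits.HodgeConjecture.HodgeConjecture.Theorems.MarkmanPartnerTransportPartnerTransportInverse
import Summits.HodgeConjecture.HodgeConjecture.Theorems.MarkmanPartnerTransportPartnerTransportIsometry

/-!
# Route MarkmanPartnerTransport · supports `PartnerTransport` / `IsometrySpannedThird` —
# transporting rational Hodge endomorphisms of `T(S)` to `T(X)` along a partner: the `E = ℚ` clause

For the partner data of `exists_markedHodgeIsometry_of_partner` (marked `(X, φ, P, z)`, marked projective
K3 `(S, η, p, x)`, the marked Hilbert square `(H, φ_H, P_H, (x,0))` with Beauville's algebraic incidence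
`θ`, and `g` with (g1), (g2), (g5)), every rational Hodge endomorphism `f_S` of `H²(S)` killing `N¹(S)`
with transcendental image is CONJUGATE, on `T(S)`, to the rational Hodge endomorphism
`f_X = e ∘ [θ]_* ∘ f_S ∘ π ∘ e⁻¹` of `H²(X)` (`e : H²(H) ⥲ H²(X)` the marked rational Hodge isometry of
`…PartnerTransportIsometry`, `π` the retraction of `…PartnerTransportIncidence`), which kills `N¹(X)` and
has `q`-transcendental image.  Consequently the `E = ℚ` clause descends from `X` to `S`:

* `hodgeEndomorphisms_scalar_of_partner` — **if every rational Hodge endomorphism of `H²(X)` killing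
  `N¹(X)` with `q`-transcendental image is a rational scalar on `T(X)`, then every rational Hodge
  endomorphism of `H²(S)` killing `N¹(S)` with transcendental image is a rational scalar on `T(S)`** —
  the hypothesis `hU₀` of the tree's kernel theorem `SquareGlueFree.hodgeConjectureFor_square_of_hodgeEndomorphisms_scalar`
  for the partner `S`.

The `X`-side hypothesis is the `k = 1, g₁ = id` instance of the route's `SpannedByIsometries X φ`
(`IsometrySpannedThird`), i.e. the «`End_Hdg T(X) = ℚ`» third at `ρ(X) ≥ 4`.
No definition, no sorry, no named fact beyond the hypothesis `Voisin2003_cupProduct_algebraicClasses`.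
Prover seat hodge-nonav-19652-p1 (gen 6), `--supports stmt-HodgeConjecture-19650`.

References: E. Markman, Compos. Math. 160 (2024) §1.1; A. Beauville, J. Differential Geom. 18 (1983) §6,
§9; Yu. Zarhin, J. reine angew. Math. 341 (1983) Thm. 1.5.1; D. Huybrechts, *Lectures on K3 Surfaces* Ch. 3.
-/

noncomputable section

set_option linter.dupNamespace false

open scoped Matrix
open Module CategoryTheory MonoidalCategory
open Literature.AlgebraicTopology.SingularHomology Literature.Geometry.Kaehler
open Literature.AlgebraicGeometry Literature.AlgebraicGeometry.Motives Literature.AlgebraicGeometry.HodgeTheory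
open Literature.AlgebraicGeometry.Hyperkaehler Literature.AlgebraicGeometry.Surfaces
open Summit.HodgeConjecture.HodgeConjecture.Theorems.NikulinTwinTransport
open Summit.HodgeConjecture.HodgeConjecture.Theorems.MarkmanPartnerTransport.BBFPositivity

namespace Summit.HodgeConjecture.HodgeConjecture.Theorems.MarkmanPartnerTransport.PartnerLattice

/-- `MarkedK3Sq[X, φ, P, z]`: VERBATIM the `let MarkedK3Sq := …` binder of the route declarations of
MarkmanPartnerTransport (clauses (m1)–(m6)). Local notation only. -/
local notation3 (prettyPrint := false) "MarkedK3Sq[" X ", " φ ", " P ", " z "]" =>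
  (((IsIntegralClass P ∧ ∀ Q : complexBetti X (2 * 4), IsIntegralClass Q → ∃ n : ℤ, Q = n • P) ∧
    (∀ c : complexBetti X 2, IsIntegralClass c ↔ ∃ v : K3HilbertIndex → ℤ, φ c = fun i => (v i : ℂ)) ∧
    (∀ a : complexBetti X 2, cupPowTwo a 4 = ((3 : ℂ) * (k3HilbertForm 2 (φ a) (φ a)) ^ 2) • P) ∧
    (IsOfHodgeType 4 X 2 2 0 (LinearEquiv.symm φ z) ∧
      ∀ τ : complexBetti X 2, IsOfHodgeType 4 X 2 2 0 τ → ∃ t : ℂ, τ = t • LinearEquiv.symm φ z) ∧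
    (∀ c : complexBetti X 2, IsOfHodgeType 4 X 2 1 1 c ↔
      (k3HilbertForm 2 (φ c) z = 0 ∧ k3HilbertForm 2 (φ c) (star z) = 0)) ∧
    (k3HilbertForm 2 z z = 0 ∧ 0 < (k3HilbertForm 2 (star z) z).re)))

variable {X S H : SchemeOver ℂ} {φ : complexBetti X 2 ≃ₗ[ℂ] (K3HilbertIndex → ℂ)} {P : complexBetti X (2 * 4)}
  {z : K3HilbertIndex → ℂ} {η : complexBetti S (2 * 1) ≃ₗ[ℂ] (K3Index → ℂ)} {p : complexBetti S (2 * 2)}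
  {x : K3Index → ℂ} {φH : complexBetti H 2 ≃ₗ[ℂ] (K3HilbertIndex → ℂ)} {PH : complexBetti H (2 * 4)}

/-- **The `E = ℚ` clause descends from `X` to its K3 partner `S`** (module docstring): conjugate a
rational Hodge endomorphism `f_S` of `H²(S)` (killing `N¹(S)`, transcendental image) by
`e ∘ [θ]_* ∘ – ∘ π ∘ e⁻¹` to one of `H²(X)` (killing `N¹(X)`, `q`-transcendental image); if the latter is
the rational scalar `a` on `T(X)`, then `f_S = a` on `T(S)` (`e`, `[θ]_*` injective, `π ∘ [θ]_* = id`).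
[cite: Markman2024, §1.1 Thm. 1.1] [cite: Zarhin1983HodgeGroupsK3, Thm. 1.5.1]
[cite: Beauville1983, §6 Prop. 6 and §9 Lemme 1] -/
theorem hodgeEndomorphisms_scalar_of_partner
    (hcup : Voisin2003_cupProduct_algebraicClasses) {μ : OrientationFamily} (hμ : μ.HasPoincareDuality)
    (hX : IsSmoothProjective 4 X) (hM : MarkedK3Sq[X, φ, P, z]) (hS : IsK3Surface S) (hp0 : p ≠ 0)
    (hηint : ∀ c : complexBetti S (2 * 1), IsIntegralClass c ↔ ∃ v : K3Index → ℤ, η c = fun i => (v i : ℂ))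
    (hcupS : ∀ a b : complexBetti S (2 * 1),
      cupProduct (rfl : 2 * 1 + 2 * 1 = 2 * 2) a b = k3Form (η a) (η b) • p)
    (h20 : IsOfHodgeType 2 S (2 * 1) 2 0 (η.symm x))
    (h20span : ∀ τ : complexBetti S (2 * 1), IsOfHodgeType 2 S (2 * 1) 2 0 τ → ∃ t : ℂ, τ = t • η.symm x)
    (hxpos : 0 < (k3Form (star x) x).re)
    (hH : IsSmoothProjective 4 H) (hMH : MarkedK3Sq[H, φH, PH, Sum.elim x 0])
    {θ : complexBetti (H ⊗ S) (2 * 2)} (hθ : θ ∈ algebraicClasses (H ⊗ S) 2)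
    (hi : ∀ a : complexBetti S (2 * 1),
      φH (corrAction μ hH (IsK3Surface.isSmoothProjective hS) (rfl : 2 * 1 + 2 * 2 = 2 + 2 * 2) θ a) =
        Sum.elim (η a) 0)
    {g : complexBetti S (2 * 1) →ₗ[ℂ] complexBetti X 2}
    (hg1 : ∀ a, IsRationalClass a → IsRationalClass (g a))
    (hg2 : ∀ (i j : ℕ) a, IsOfHodgeType 2 S (2 * 1) i j a → IsOfHodgeType 4 X 2 i j (g a))
    (hg5 : ∀ a b, (∀ d ∈ algebraicClasses S 1, cupProduct (rfl : 2 * 1 + 2 * 1 = 2 * 2) a d = 0) →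
      (∀ d ∈ algebraicClasses S 1, cupProduct (rfl : 2 * 1 + 2 * 1 = 2 * 2) b d = 0) →
      k3HilbertForm 2 (φ (g a)) (φ (g b)) = k3Form (η a) (η b))
    (hQX : ∀ f : complexBetti X 2 →ₗ[ℂ] complexBetti X 2,
      (∀ y, IsRationalClass y → IsRationalClass (f y)) →
      (∀ (i j : ℕ) y, IsOfHodgeType 4 X 2 i j y → IsOfHodgeType 4 X 2 i j (f y)) →
      (∀ d : complexBetti X 2, d ∈ algebraicClasses X 1 → f d = 0) →
      (∀ y : complexBetti X 2, ∀ d : complexBetti X 2, d ∈ algebraicClasses X 1 →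
        k3HilbertForm 2 (φ (f y)) (φ d) = 0) →
      ∃ a : ℚ, ∀ y : complexBetti X 2,
        (∀ d : complexBetti X 2, d ∈ algebraicClasses X 1 → k3HilbertForm 2 (φ y) (φ d) = 0) →
        f y = (a : ℂ) • y) :
    ∀ fS : complexBetti S (2 * 1) →ₗ[ℂ] complexBetti S (2 * 1),
      (∀ y, IsRationalClass y → IsRationalClass (fS y)) →
      (∀ (i j : ℕ) y, IsOfHodgeType 2 S (2 * 1) i j y → IsOfHodgeType 2 S (2 * 1) i j (fS y)) →
      (∀ d ∈ algebraicClasses S 1, fS d = 0) →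
      (∀ y : complexBetti S (2 * 1), ∀ d ∈ algebraicClasses S 1,
        cupProduct (rfl : 2 * 1 + 2 * 1 = 2 * 2) (fS y) d = 0) →
      ∃ a : ℚ, ∀ y : complexBetti S (2 * 1),
        (∀ d ∈ algebraicClasses S 1, cupProduct (rfl : 2 * 1 + 2 * 1 = 2 * 2) y d = 0) →
        fS y = (a : ℂ) • y := by
  classical
  intro fS hr hh hk ht
  obtain ⟨-, hint, -, ⟨hz20, hz20span⟩, -⟩ := id hM
  obtain ⟨-, hintH, -⟩ := id hMH
  have hS2 : IsSmoothProjective 2 S := IsK3Surface.isSmoothProjective hS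
  -- the marked rational Hodge isometry `e : H²(H) ⥲ H²(X)` and its inverse
  obtain ⟨f, hfbij, hfrat, hfh, hfq⟩ := exists_markedHodgeIsometry_of_partner hcup hμ hX hM hS hηint hcupS
    h20 hxpos hH hMH hθ hi hg1 hg2 hg5
  obtain ⟨e, he, herat, heh, -⟩ := exists_inverse_markedHodgeIsometry hH hX hMH hM hfbij hfrat hfh hfq
  have herat' : ∀ c, IsRationalClass c → IsRationalClass (e c) := fun c hc => by rw [he]; exact hfrat c hc
  have heh' : ∀ (i j : ℕ) c, IsOfHodgeType 4 H 2 i j c → IsOfHodgeType 4 X 2 i j (e c) :=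
    fun i j c hc => by rw [he]; exact hfh i j c hc
  have heq : ∀ a b, k3HilbertForm 2 (φ (e a)) (φ (e b)) = k3HilbertForm 2 (φH a) (φH b) :=
    fun a b => by rw [he, he]; exact hfq a b
  -- `e⁻¹(N¹(X)) ⊆ N¹(H)`
  have hsymmN : ∀ d ∈ algebraicClasses X 1, e.symm d ∈ algebraicClasses H 1 := fun d hd =>
    map_mem_algebraicClasses_of_isRationalClass_of_oneOne hX hH (e.symm : complexBetti X 2 →ₗ[ℂ] complexBetti H 2)
      herat (heh 1 1) hd
  -- `i` and `π`
  set i : complexBetti S (2 * 1) →ₗ[ℂ] complexBetti H 2 :=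
    corrAction μ hH hS2 (rfl : 2 * 1 + 2 * 2 = 2 + 2 * 2) θ with hidef
  have hi' : ∀ a, φH (i a) = Sum.elim (η a) 0 := hi
  set π : complexBetti H 2 →ₗ[ℂ] complexBetti S (2 * 1) :=
    (η.symm : (K3Index → ℂ) →ₗ[ℂ] complexBetti S (2 * 1)) ∘ₗ
      LinearMap.funLeft ℂ ℂ (Sum.inl : K3Index → K3HilbertIndex) ∘ₗ
      (φH : complexBetti H 2 →ₗ[ℂ] (K3HilbertIndex → ℂ)) with hπdef
  have hπ : ∀ w, π w = η.symm (fun k => φH w (Sum.inl k)) := fun w => rfl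
  -- `e ∘ i` carries cup-transcendental classes to `q`-transcendental classes
  have heiT : ∀ t : complexBetti S (2 * 1),
      (∀ d ∈ algebraicClasses S 1, cupProduct (rfl : 2 * 1 + 2 * 1 = 2 * 2) t d = 0) →
      ∀ d : complexBetti X 2, d ∈ algebraicClasses X 1 → k3HilbertForm 2 (φ (e (i t))) (φ d) = 0 := by
    intro t htt d hd
    have h1 : k3HilbertForm 2 (φ (e (i t))) (φ d) = k3HilbertForm 2 (φ (e (i t))) (φ (e (e.symm d))) := by
      rw [LinearEquiv.apply_symm_apply]
    rw [h1, heq]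
    exact incidence_bbfTransc hS hp0 hηint hcupS h20 hxpos hH hMH hi' htt _ (hsymmN d hd)
  -- the conjugated endomorphism `fX = e ∘ i ∘ fS ∘ π ∘ e⁻¹`
  set fX : complexBetti X 2 →ₗ[ℂ] complexBetti X 2 :=
    (e : complexBetti H 2 →ₗ[ℂ] complexBetti X 2) ∘ₗ i ∘ₗ fS ∘ₗ π ∘ₗ
      (e.symm : complexBetti X 2 →ₗ[ℂ] complexBetti H 2) with hfXdef
  have hfX : ∀ c, fX c = e (i (fS (π (e.symm c)))) := fun c => rfl
  -- rational
  have h1 : ∀ c, IsRationalClass c → IsRationalClass (fX c) := by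
    intro c hc
    rw [hfX]
    refine herat' _ (isRationalClass_incidence hS hH hηint hintH hi' (hr _ ?_))
    rw [hπ]
    exact isRationalClass_retraction hS hH hηint hintH (herat c hc)
  -- kills `N¹(X)`
  have h3 : ∀ d : complexBetti X 2, d ∈ algebraicClasses X 1 → fX d = 0 := by
    intro d hd
    rw [hfX, hπ, hk _ (retraction_mem_algebraicClasses hS hp0 hηint hcupS h20 hxpos hH hMH (hsymmN d hd)),
      map_zero, map_zero]
  -- `q`-transcendental image
  have h4 : ∀ y : complexBetti X 2, ∀ d : complexBetti X 2, d ∈ algebraicClasses X 1 →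
      k3HilbertForm 2 (φ (fX y)) (φ d) = 0 := by
    intro y d hd
    rw [hfX]
    exact heiT _ (ht _) d hd
  -- Hodge types `(2,0)` and `(1,1)` through the chain, `(0,2)` by conjugation
  have h20X : ∀ c, IsOfHodgeType 4 X 2 2 0 c → IsOfHodgeType 4 X 2 2 0 (fX c) := by
    intro c hc
    rw [hfX]
    refine heh' 2 0 _ (incidence_twoZero hMH h20span hi' (hh 2 0 _ ?_))
    rw [hπ]
    exact retraction_twoZero hMH h20 (heh 2 0 c hc)
  have h11X : ∀ c, IsOfHodgeType 4 X 2 1 1 c → IsOfHodgeType 4 X 2 1 1 (fX c) := by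
    intro c hc
    rw [hfX]
    refine heh' 1 1 _ (incidence_oneOne hS hp0 hηint hcupS h20 hxpos hMH hi' (hh 1 1 _ ?_))
    rw [hπ]
    exact retraction_oneOne hS hp0 hηint hcupS h20 hxpos hMH (heh 1 1 c hc)
  have hfXconj : ∀ c, fX (conjClass (ComplexPoints X) 2 c) = conjClass (ComplexPoints X) 2 (fX c) :=
    conjClass_map_of_isRationalClass hX hX hint hint fX h1
  have h2 : ∀ (a b : ℕ) c, IsOfHodgeType 4 X 2 a b c → IsOfHodgeType 4 X 2 a b (fX c) := by
    intro a b c hc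
    by_cases hab : a + b = 2
    · have ha2 : a ≤ 2 := by omega
      interval_cases a
      · have hb : b = 2 := by omega
        subst hb
        rw [← conjClass_conjClass (fX c), ← hfXconj]
        exact (h20X _ (hc.conjClass hX)).conjClass hX
      · have hb : b = 1 := by omega
        subst hb
        exact h11X c hc
      · have hb : b = 0 := by omega
        subst hb
        exact h20X c hc
    · have hc0 : c = 0 := by
        obtain ⟨A, hA⟩ := hc
        rw [(A.hodgePQ_eq_bot_iff 2 a b).2
            (Literature.NumberTheory.Transcendental.hodgePQ_eq_bot_of_ne (M := A.carrier) hab),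
          Submodule.mem_bot] at hA
        exact A.pullback_injective 2 (by rw [hA, map_zero])
      rw [hc0, map_zero]
      exact isOfHodgeType_zero_of_isSmoothProjective nonempty_hodgeModel_holds hX 2 a b
  -- the scalar on `T(X)` descends to `T(S)`
  obtain ⟨a, ha⟩ := hQX fX h1 h2 h3 h4
  refine ⟨a, fun t htt => ?_⟩
  have hy := ha (e (i t)) (heiT t htt)
  rw [hfX, LinearEquiv.symm_apply_apply, hπ, retraction_incidence hi' t] at hy
  have hy' : e (i (fS t)) = e (i ((a : ℂ) • t)) := by rw [hy, map_smul, map_smul]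
  exact incidence_injective hi' (e.injective hy')

end Summit.HodgeConjecture.HodgeConjecture.Theorems.MarkmanPartnerTransport.PartnerLattice

end
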